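import Literature.Analysis.ValidatedNumerics.TaylorModelQuadrature
import HarnessLib

/-!
# The `L²` norm of a Taylor-modelled function over a panel, and partial moments against `u^b`

Trunk T-ANA (Analysis/ValidatedNumerics); namespace `Literature.Analysis.ValidatedNumerics.PolyMP`.
Sequel of `TaylorModel.lean` and `TaylorModelQuadrature.lean`.  Two generic certified-integration rules for a
function `f` enclosed on a panel `|ρ| ≤ h` by a Taylor model `P` (`TMem S h f P`), stated — as in
`abs_integral_mul_sub_integPolyQ_le` — relative to a user-supplied rational polynomial `p` (in practice the midpoint
polynomial of `P`) and the kernel-computed scaled sup bound `B = tabsI S h (P − p)` of `f − p`: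

* `integral_sq_le_sqIntegUpperQ` — `∫_{-h}^{h} f(ρ)² dρ ≤ ∫_{-h}^{h} p² + 2h·(2‖p‖_h·(B/S) + (B/S)²)`
  (`sqIntegUpperQ S h P p`, an exact rational; `‖p‖_h = absBoundQ p h ≥ sup_{|ρ|≤h} |p(ρ)|`): the squared `L²` norm
  of a validated function over one panel — the building block of certified RESIDUAL NORMS `‖F − Σ W v‖²₂`
  (sigma criterion of the deflated Temple / Lehmann–Goerisch eigenvalue bounds);
* `tmem_partialMoment` — the PARTIAL MOMENTS `λ ↦ ∫_{-h}^{λ} f(u) u^b du`, `|λ| ≤ h`, are enclosed by the Taylor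
  model `widen0 (ratPolyI S (partMomPoly p b h)) e` whenever `B · 2h · h^b ≤ e`: exact polynomial part
  `∫_{-h}^{λ} p(u)u^b du` (`partMomPoly`, via the antiderivative `Poly.ad 0`) plus the remainder folded into the constant
  coefficient — the rule by which an integral `∫_0^{L} w(t) q(t) dt` with a panelled weight `w` and an endpoint `L`
  MOVING inside a panel becomes a Taylor model in `L` (window images of the Weil form, incomplete moments).

Problem-independent; no facts, no axioms.

## References

* K. Makino, M. Berz, *Taylor models and other validated functional inclusion methods*, Int. J. Pure Appl. Math. 4
  (2003) 379–456, §6 (validated integration / antiderivation of Taylor models). [folklore]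
-/

open MeasureTheory intervalIntegral Set
open scoped Interval

namespace Literature.Analysis.ValidatedNumerics

namespace PolyMP

open Literature.Analysis.ValidatedNumerics.NumericsMP
open Literature.Analysis.ValidatedNumerics.ExpPoly (Poly)
open Literature.Analysis.ValidatedNumerics.ExpPoly

/-! ### Pointwise consequences of a Taylor model and a reference polynomial -/

/-- On the panel, `|f − p| ≤ B/S` with `B = tabsI S h (P − p)`. [folklore] -/
theorem abs_sub_poly_le_of_tmem {S : ℕ} (hS : 0 < S) {h : ℚ} (h0 : 0 ≤ h) {f : ℝ → ℝ} {P : IPoly}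
    (hf : TMem S h f P) (p : Poly) {ρ : ℝ} (hρ : |ρ| ≤ h) :
    |f ρ - Poly.eval p ρ| ≤ (tabsI S h (tsubI P (ratPolyI S p)) : ℝ) / S := by
  have hSr : (0 : ℝ) < S := by exact_mod_cast hS
  rw [le_div_iff₀ hSr]
  exact abs_le_tabsI h0 (tmem_sub hf (tmem_ratPoly S h p)) hρ

/-- On the panel, `f² ≤ p² + (2‖p‖_h·δ + δ²)`, `δ = B/S`. [folklore] -/
theorem sq_le_of_tmem {S : ℕ} (hS : 0 < S) {h : ℚ} (h0 : 0 ≤ h) {f : ℝ → ℝ} {P : IPoly}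
    (hf : TMem S h f P) (p : Poly) {ρ : ℝ} (hρ : |ρ| ≤ h) :
    f ρ ^ 2 ≤ Poly.eval p ρ ^ 2 +
      (2 * absBoundQ p h * ((tabsI S h (tsubI P (ratPolyI S p)) : ℝ) / S) +
        ((tabsI S h (tsubI P (ratPolyI S p)) : ℝ) / S) ^ 2) := by
  set δ : ℝ := (tabsI S h (tsubI P (ratPolyI S p)) : ℝ) / S with hδ
  have h1 : |f ρ - Poly.eval p ρ| ≤ δ := abs_sub_poly_le_of_tmem hS h0 hf p hρ
  have h2 : |Poly.eval p ρ| ≤ ((absBoundQ p h : ℚ) : ℝ) := abs_eval_le_absBoundQ p hρ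
  have hδ0 : 0 ≤ δ := (abs_nonneg _).trans h1
  have h3 : |f ρ + Poly.eval p ρ| ≤ δ + 2 * absBoundQ p h := by
    calc |f ρ + Poly.eval p ρ| = |(f ρ - Poly.eval p ρ) + 2 * Poly.eval p ρ| := by ring_nf
      _ ≤ |f ρ - Poly.eval p ρ| + |2 * Poly.eval p ρ| := abs_add_le _ _
      _ ≤ δ + 2 * absBoundQ p h := by
          rw [abs_mul, abs_two]; linarith
  have h4 : f ρ ^ 2 - Poly.eval p ρ ^ 2 ≤ δ * (δ + 2 * absBoundQ p h) := by
    have e : f ρ ^ 2 - Poly.eval p ρ ^ 2 = (f ρ - Poly.eval p ρ) * (f ρ + Poly.eval p ρ) := by ring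
    rw [e]
    calc (f ρ - Poly.eval p ρ) * (f ρ + Poly.eval p ρ) ≤ |(f ρ - Poly.eval p ρ) * (f ρ + Poly.eval p ρ)| :=
          le_abs_self _
      _ = |f ρ - Poly.eval p ρ| * |f ρ + Poly.eval p ρ| := abs_mul _ _
      _ ≤ δ * (δ + 2 * absBoundQ p h) := mul_le_mul h1 h3 (abs_nonneg _) hδ0
  linarith

/-! ### The squared `L²` norm over a panel -/

/-- `∫_{-h}^{h} p² + 2h·(2‖p‖_h·(B/S) + (B/S)²)` as an exact rational, `B = tabsI S h (P − p)`. [folklore] -/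
def sqIntegUpperQ (S : ℕ) (h : ℚ) (P : IPoly) (p : Poly) : ℚ :=
  integPolyQ p p h + 2 * h * (2 * absBoundQ p h * ((tabsI S h (tsubI P (ratPolyI S p)) : ℚ) / S) +
    (((tabsI S h (tsubI P (ratPolyI S p)) : ℚ) / S) ^ 2))

/-- **Squared `L²` norm of a Taylor-modelled function over a panel.**  If `P` encloses `f` on `|ρ| ≤ h` and `f²` is
interval integrable there, then for every rational polynomial `p`,
`∫_{-h}^{h} f² ≤ sqIntegUpperQ S h P p = ∫ p² + 2h(2‖p‖_h δ + δ²)`, `δ = tabsI S h (P − p)/S`. [folklore] -/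
theorem integral_sq_le_sqIntegUpperQ {S : ℕ} (hS : 0 < S) {h : ℚ} (h0 : 0 ≤ h) {f : ℝ → ℝ} {P : IPoly}
    (hf : TMem S h f P) (hfi : IntervalIntegrable (fun ρ => f ρ ^ 2) volume (-(h : ℝ)) h) (p : Poly) :
    ∫ ρ in (-(h : ℝ))..h, f ρ ^ 2 ≤ ((sqIntegUpperQ S h P p : ℚ) : ℝ) := by
  set δ : ℝ := (tabsI S h (tsubI P (ratPolyI S p)) : ℝ) / S with hδ
  have hh : (-(h : ℝ)) ≤ h := by linarith [(by exact_mod_cast h0 : (0 : ℝ) ≤ h)]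
  have hpc : Continuous fun ρ => Poly.eval p ρ ^ 2 + (2 * absBoundQ p h * δ + δ ^ 2) :=
    ((Poly.continuous_eval p).pow 2).add continuous_const
  have hmono : ∫ ρ in (-(h : ℝ))..h, f ρ ^ 2 ≤
      ∫ ρ in (-(h : ℝ))..h, (Poly.eval p ρ ^ 2 + (2 * absBoundQ p h * δ + δ ^ 2)) := by
    refine intervalIntegral.integral_mono_on hh hfi (hpc.intervalIntegrable _ _) fun ρ hρ => ?_
    exact sq_le_of_tmem hS h0 hf p (abs_le.2 ⟨by linarith [hρ.1], hρ.2⟩)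
  refine hmono.trans (le_of_eq ?_)
  rw [intervalIntegral.integral_add (f := fun ρ => Poly.eval p ρ ^ 2)
    (g := fun _ => 2 * (absBoundQ p h : ℝ) * δ + δ ^ 2) (((Poly.continuous_eval p).pow 2).intervalIntegrable _ _)
    (continuous_const.intervalIntegrable _ _), intervalIntegral.integral_const]
  have hp2 : ∫ ρ in (-(h : ℝ))..h, Poly.eval p ρ ^ 2 = ((integPolyQ p p h : ℚ) : ℝ) := by
    rw [← integral_eval_mul_eval]
    exact intervalIntegral.integral_congr fun ρ _ => by simp only [pow_two]
  rw [hp2, sqIntegUpperQ]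
  push_cast
  ring

/-! ### Partial moments `∫_{-h}^{λ} f(u) u^b du` as a Taylor model in `λ` -/

/-- The monomial `u^b` as a coefficient list. [folklore] -/
def monomialQ (b : ℕ) : Poly := List.replicate b 0 ++ [1]

/-- [folklore] -/
theorem eval_monomialQ (b : ℕ) (x : ℝ) : Poly.eval (monomialQ b) x = x ^ b := by
  induction b with
  | zero => simp [monomialQ, Poly.eval]
  | succ n ih =>
      have e : monomialQ (n + 1) = 0 :: monomialQ n := by simp [monomialQ, List.replicate_succ]
      rw [e, Poly.eval, ih, Rat.cast_zero, zero_add, pow_succ]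
      ring

/-- The exact polynomial `λ ↦ ∫_{-h}^{λ} p(u) u^b du` (antiderivative of `p·u^b` minus its value at `−h`). [folklore] -/
def partMomPoly (p : Poly) (b : ℕ) (h : ℚ) : Poly :=
  Poly.add (Poly.ad 0 (Poly.mul p (monomialQ b))) [-(Poly.evalQ (Poly.ad 0 (Poly.mul p (monomialQ b))) (-h))]

/-- [folklore] -/
theorem eval_partMomPoly (p : Poly) (b : ℕ) (h : ℚ) (x : ℝ) :
    Poly.eval (partMomPoly p b h) x =
      Poly.eval (Poly.ad 0 (Poly.mul p (monomialQ b))) x -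
        Poly.eval (Poly.ad 0 (Poly.mul p (monomialQ b))) (-(h : ℝ)) := by
  rw [partMomPoly, Poly.eval_add]
  have e : Poly.eval [-(Poly.evalQ (Poly.ad 0 (Poly.mul p (monomialQ b))) (-h))] x =
      -Poly.eval (Poly.ad 0 (Poly.mul p (monomialQ b))) (-(h : ℝ)) := by
    simp only [Poly.eval, mul_zero, add_zero, Rat.cast_neg]
    rw [Poly.eval_evalQ, Rat.cast_neg]
  rw [e]
  ring

/-- `∫_{-h}^{λ} p(u) u^b du = partMomPoly p b h (λ)`. [folklore] -/
theorem integral_poly_mul_pow_eq (p : Poly) (b : ℕ) (h : ℚ) (x : ℝ) :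
    ∫ u in (-(h : ℝ))..x, Poly.eval p u * u ^ b = Poly.eval (partMomPoly p b h) x := by
  rw [eval_partMomPoly]
  have h1 : ∫ u in (-(h : ℝ))..x, Poly.eval p u * u ^ b =
      ∫ u in (-(h : ℝ))..x, Poly.eval (Poly.mul p (monomialQ b)) u :=
    intervalIntegral.integral_congr fun u _ => by simp only [Poly.eval_mul, eval_monomialQ]
  rw [h1, integral_eq_sub_of_hasDerivAt (fun u _ => hasDerivAt_eval_ad_zero (Poly.mul p (monomialQ b)) u)
    ((Poly.continuous_eval _).intervalIntegrable _ _)]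

/-- **Partial moments of a Taylor-modelled function.**  If `P` encloses `f` on `|u| ≤ h`, `f` is interval integrable
on `[-h, h]`, and `tabsI S h (P − p) · (2h · h^b) ≤ e`, then the Taylor model `widen0 (ratPolyI S (partMomPoly p b h)) e`
encloses `λ ↦ ∫_{-h}^{λ} f(u) u^b du` on `|λ| ≤ h`. [folklore] -/
theorem tmem_partialMoment {S : ℕ} (hS : 0 < S) {h : ℚ} (h0 : 0 ≤ h) {f : ℝ → ℝ} {P : IPoly}
    (hf : TMem S h f P) (hfi : IntervalIntegrable f volume (-(h : ℝ)) h) (p : Poly) (b : ℕ) {e : ℕ}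
    (he : (tabsI S h (tsubI P (ratPolyI S p)) : ℚ) * (2 * h * h ^ b) ≤ e) :
    TMem S h (fun x => ∫ u in (-(h : ℝ))..x, f u * u ^ b) (widen0 (ratPolyI S (partMomPoly p b h)) e) := by
  intro x hx
  set B : ℤ := tabsI S h (tsubI P (ratPolyI S p)) with hB
  have hSr : (0 : ℝ) < S := by exact_mod_cast hS
  have hhr : (0 : ℝ) ≤ h := by exact_mod_cast h0
  have hxI : x ∈ Icc (-(h : ℝ)) h := ⟨by linarith [(abs_le.1 hx).1], (abs_le.1 hx).2⟩
  -- integrability on the sub-interval `[-h, x]`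
  have hfx : IntervalIntegrable f volume (-(h : ℝ)) x :=
    hfi.mono_set (by rw [uIcc_of_le (by linarith [hxI.1] : (-(h : ℝ)) ≤ x),
      uIcc_of_le (by linarith : (-(h : ℝ)) ≤ h)]; exact Icc_subset_Icc le_rfl hxI.2)
  have hcb : Continuous fun u : ℝ => u ^ b := continuous_id.pow b
  have hfb : IntervalIntegrable (fun u => f u * u ^ b) volume (-(h : ℝ)) x :=
    hfx.mul_continuousOn hcb.continuousOn
  have hpb : IntervalIntegrable (fun u => Poly.eval p u * u ^ b) volume (-(h : ℝ)) x :=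
    ((Poly.continuous_eval p).mul hcb).intervalIntegrable _ _
  -- the remainder `δ = ∫_{-h}^{x} (f − p) u^b`
  set δ : ℝ := (∫ u in (-(h : ℝ))..x, f u * u ^ b) - ∫ u in (-(h : ℝ))..x, Poly.eval p u * u ^ b with hδ
  have hδ' : δ = ∫ u in (-(h : ℝ))..x, (f u * u ^ b - Poly.eval p u * u ^ b) := by
    rw [hδ, intervalIntegral.integral_sub hfb hpb]
  have hpt : ∀ u ∈ Ι (-(h : ℝ)) x, ‖f u * u ^ b - Poly.eval p u * u ^ b‖ ≤ (B : ℝ) / S * h ^ b := by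
    intro u hu
    rw [uIoc_of_le (by linarith [hxI.1] : (-(h : ℝ)) ≤ x)] at hu
    have hua : |u| ≤ h := abs_le.2 ⟨hu.1.le, hu.2.trans hxI.2⟩
    rw [Real.norm_eq_abs, ← sub_mul, abs_mul, abs_pow]
    have h1 : |f u - Poly.eval p u| ≤ (B : ℝ) / S := abs_sub_poly_le_of_tmem hS h0 hf p hua
    exact mul_le_mul h1 (pow_le_pow_left₀ (abs_nonneg u) hua b) (by positivity)
      ((abs_nonneg _).trans h1)
  have hδb : |δ| ≤ (B : ℝ) / S * h ^ b * (2 * h) := by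
    rw [hδ']
    refine (norm_integral_le_of_norm_le_const hpt).trans ?_
    have hlen : |x - -(h : ℝ)| ≤ 2 * h := by
      rw [abs_le]; constructor <;> linarith [hxI.1, hxI.2]
    have hB0 : 0 ≤ (B : ℝ) / S * h ^ b := by
      have : 0 ≤ (B : ℝ) / S := (abs_nonneg _).trans (abs_sub_poly_le_of_tmem hS h0 hf p
        (by rw [abs_zero]; exact hhr : |(0 : ℝ)| ≤ h))
      positivity
    exact mul_le_mul_of_nonneg_left hlen hB0
  have hδS : |δ| * S ≤ (e : ℤ) := by
    have he' : (B : ℝ) * (2 * h * h ^ b) ≤ e := by exact_mod_cast he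
    have : |δ| * S ≤ (B : ℝ) / S * h ^ b * (2 * h) * S := mul_le_mul_of_nonneg_right hδb hSr.le
    rw [div_mul_eq_mul_div, div_mul_eq_mul_div, div_mul_cancel₀ _ hSr.ne'] at this
    push_cast
    linarith
  obtain ⟨bs, hbs, hev⟩ := exists_widen0 (pmem_ratPoly S (partMomPoly p b h)) hδS x
  refine ⟨bs, hbs, ?_⟩
  rw [hev, ← Poly.eval_eq_evalR, ← integral_poly_mul_pow_eq, hδ]
  ring

end PolyMP

end Literature.Analysis.ValidatedNumerics
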